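import Mathlib
import HarnessLib
import Summits.HubbardSuperconductivity.HubbardSuperconductivity.Theorems.KLProgrammeKLRegimeEnginePairTransferGridSmearing
import Summits.HubbardSuperconductivity.HubbardSuperconductivity.Theorems.KLProgrammeKLRegimeEnginePairTransferBaseBinomial

/-!
# Route `KLProgramme` — ENGINE child gen 8 (stmt-HubbardSuperconductivity-20437 `KLRegimeEngineV17F2`), skeleton v2 class #5 rev 3, Ẽ-organisation: the BASE smearing row IN GRID
# CURRENCY — **`klmg_covSmearedPairAmplitude_sub_le_gridBinomial`**, **`klmf_baseData_of_gridBinomial`** (row 28 `klmf_baseData_of_binomial` re-keyed on the grid pullback;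
# cure of the located «(X).3-BINOMIAL-CURRENCY», HOME/STATUS k3c1-p1 g14)
# (cell gate-hubbard-kl, seat hubbard-kl-k3c1-p1 g14, technique «composed-map remainder propagation»)

WHY.  The (X).3 producer's BASE (row 26 `pairTransferStep7_of_analytic`, clause `hbase`) asks per pair `(s_{0,j} | s_{0,j′})`, `0 ≤ j′ ≤ j`, class `Qm`, for an OPAQUE smearing
estimate `‖(A₀[s_{0,j}] − A₀[s_{0,j′}])(k,k′)‖ ≤ η k k′` on the ball plus the ONE-NUMBER row `η + mA²·Σ|t₀[s_j] − t₀[s_j′]| ≤ θ·transferBarRelIdx … 0 j′`.  Row 28 supplied `η` from a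
MOMENTUM-label Gram constant of the `D`-line and pinned momentum kernel sums — a true but EXTENSIVE currency (`κ² ≥ βL²·sup φ_D/ρ_K`), so the number row of rows 30/37b/41b is
unsatisfiable for large `L, M`.  This file is row 28 in the sound GRID currency of k3c2-p1 g5's `norm_klCovSmearedPairAmplitude_zero_sub_le_of_gridStep`:
* **`klmg_covSmearedPairAmplitude_sub_le_gridBinomial`** — at any scale `n` and frame `K`, for symbols `ψ₁ ψ₂`: with `S = hubbardGridSub … (4M)`, `IsGramBoundedR (Sᵀ·softCovOf K (ψ₁ − ψ₂)·S) κD`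
  [the `D`-line's MASS, `klmg_isGramBoundedR_gridSub_softCovOf_of_mass_le`, `∝ klIdxMass`] and the pinned GRID kernel norms `N_H` of the smeared grid action
  `H = e^{Δ_{Sᵀ·softCovOf K ψ₂·S}}·effAction (SᵀC^K_{>Λₙ}S)(V_N + 𝒩_{K,N})` [scale-0 lane: first-order binomial × graded determinant bounds, `γ² ≤ 6047`]:
  `‖𝒜ₙ[S_{ψ₁}](Q;k,k′) − 𝒜ₙ[S_{ψ₂}](Q;k,k′)‖ ≤ (4!/(βL²))·(#legs·Σ_{m′ > 2} C(2m′,4)·κD^{2m′−4}·N_H(m′))` (`𝒜ₙ[D] = klCovSmearedPairAmplitude … K n D`);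
* **`klmf_baseData_of_gridBinomial`** — the BASE existential of rows 26/26b at the bar `θ·transferBarRelIdx L G P r β U 0 j′` from: `κD` (grid Gram of the `D`-line at `K₀`), `N_H`
  (pinned grid norms of `e^{Δ_{SᵀS_{0,j′}S}}Gg₀`, `Gg₀ = effAction (SᵀC^{K₀}_{>e₀}S) Ṽ`), the two a priori rows, and the ONE NUMBER
  `(4!/(βL²))·(#legs·Σ_{m′>2} C(2m′,4)κD^{2m′−4}N_H(m′)) + 4·mA²·klIdxMass 0 j′ ≤ θ·r·(KlamU)²·klIdxMass 0 j′` — every term intensive (`#legs/(βL²) = 16M/β` against the grid vertex scale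
  `β/(4M)` inside `N_H`; `κD² ∝ klIdxMass 0 j′`).
Plumbing over `…GridSmearing` + row 28's floor/mass lemmas; nothing about the model's sizes is asserted; nothing asserts (X).3, (c), K3 or superconductivity.  0 kit · 0 lit.
-/

noncomputable section

namespace Summit.HubbardSuperconductivity.HubbardSuperconductivity.Theorems.KLRegimeSplit

set_option linter.dupNamespace false -- summit = problem name (single-conjunct summit), D-0017

open Finset Matrix Set Literature.MathematicalPhysics.QuantumLattice Literature.Probability.LatticeModels GrassmannAlgebra
open Summit.HubbardSuperconductivity.HubbardSuperconductivity.Theorems.KLProgrammeCooperResummation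
open Summit.HubbardSuperconductivity.HubbardSuperconductivity.Theorems.KLProgrammeLegKernels
open Summit.HubbardSuperconductivity.HubbardSuperconductivity.Theorems.DispersionFlow
open Summit.HubbardSuperconductivity.HubbardSuperconductivity.Theorems.KLRegimeWick
open Summit.HubbardSuperconductivity.HubbardSuperconductivity.Theorems.EngineV8

/-! ## §1 The member difference at any scale, grid currency -/

section Difference

variable (L M : ℕ) [NeZero L] [NeZero M]

/-- **`klmg_covSmearedPairAmplitude_sub_le_gridBinomial`** — `‖𝒜ₙ[S_{ψ₁}](Q;k,k′) − 𝒜ₙ[S_{ψ₂}](Q;k,k′)‖ ≤ (4!/(βL²))·(#legs·Σ_{m′} [2 < m′]·C(2m′,4)·κD^{2m′−4}·N_H(m′))` from the grid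
Gram constant `κD` of the `D`-line `Sᵀ·softCovOf K (ψ₁ − ψ₂)·S` and the pinned grid kernel norms `N_H` of `e^{Δ_{Sᵀ·softCovOf K ψ₂·S}}·effAction (SᵀC^K_{>Λₙ}S)(V_N + 𝒩_{K,N})`. -/
theorem klmg_covSmearedPairAmplitude_sub_le_gridBinomial {β : ℝ} (hβ : 0 < β) (U μ : ℝ) (K : TrigPolyC4v) (n : ℕ) (ψ₁ ψ₂ : FreqMomentum L M → ℝ)
    {κD : ℝ} (hκD : 0 ≤ κD)
    (hGBD : IsGramBoundedR ((hubbardGridSub L M β (2 * (2 * M))).transpose * softCovOf L M β μ K (ψ₁ - ψ₂) * hubbardGridSub L M β (2 * (2 * M))) κD)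
    (NH : ℕ → ℝ) (hNH0 : ∀ m', 0 ≤ NH m')
    (hNH : ∀ m' (j : Fin (2 * m')) (w : GridLeg (GridPoint L (2 * (2 * M)))),
      ∑ Y ∈ univ.filter (fun Y : Fin (2 * m') → GridLeg (GridPoint L (2 * (2 * M))) => Y j = w),
        ‖kernel ℂ (gaussConv ℂ ((hubbardGridSub L M β (2 * (2 * M))).transpose * softCovOf L M β μ K ψ₂ * hubbardGridSub L M β (2 * (2 * M)))
          (effAction ℂ ((hubbardGridSub L M β (2 * (2 * M))).transpose * hubbardCovAboveCT L M β μ 0 K (klScale klE0 n) * hubbardGridSub L M β (2 * (2 * M)))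
            (hubbardGridInteraction L (2 * (2 * M)) β U + hubbardGridCounterQuadratic L (2 * (2 * M)) β K))) (2 * m') Y‖ ≤ NH m')
    (Q k k' : TorusSite 2 L) :
    ‖klCovSmearedPairAmplitude L M β U μ K n (softCovOf L M β μ K ψ₁) Q k k' - klCovSmearedPairAmplitude L M β U μ K n (softCovOf L M β μ K ψ₂) Q k k'‖ ≤
      ((2 * 2).factorial : ℝ) / (β * (L : ℝ) ^ 2) * (Fintype.card (GridLeg (GridPoint L (2 * (2 * M)))) *
        ∑ m' ∈ range (Fintype.card (GridLeg (GridPoint L (2 * (2 * M)))) / 2 + 1), if 2 < m' then ((2 * m').choose (2 * 2) : ℝ) * κD ^ (2 * m' - 2 * 2) * NH m' else 0) := by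
  have hsplit : softCovOf L M β μ K ψ₁ = softCovOf L M β μ K (ψ₁ - ψ₂) + softCovOf L M β μ K ψ₂ := klmf_softCovOf_eq_sub_add L M β μ K ψ₁ ψ₂
  have hV : klEffectiveAction L M β U μ K klE0 n = hubbardEffectiveActionCT L M β U μ 0 K (klScale klE0 n) := rfl
  rw [klCovSmearedPairAmplitude, klCovSmearedPairAmplitude, hV, hsplit,
    klmg_carrier_eq_map_grid L M β U μ K hβ.ne' (softCovOf L M β μ K (ψ₁ - ψ₂) + softCovOf L M β μ K ψ₂),
    klmg_carrier_eq_map_grid L M β U μ K hβ.ne' (softCovOf L M β μ K ψ₂), Matrix.mul_add, Matrix.add_mul, gaussConv_add_apply]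
  exact klmg_vertexFn_map_gaussConv_sub_le_binomial L M β hβ _ hκD hGBD _
    ((mem_evenPart_iff).2 (gaussConv_mem_evenOdd ℂ _ ((mem_evenPart_iff).1 (klmg_gridAction_mem_evenPart L β U K _)))) NH hNH0 hNH (p := 2) (by norm_num) _

end Difference

/-! ## §2 The BASE data from grid binomial data (row 28′) -/

section Base

variable (L M : ℕ) [NeZero L] [NeZero M]

set_option maxHeartbeats 800000 in -- composition with long model expressions (as row 28)
/-- **`klmf_baseData_of_gridBinomial`** — for the pair `(s_{0,j} | s_{0,j′})`, `0 ≤ j′ ≤ j`, and class `Qm` at the bare frame `K₀ = klFlowFrameU … 0` (`FrameOK`, `klBetaMin ≤ β ≤ L`):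
the BASE existential of rows 26/26b (`pairTransferStep7_of_analytic`, `exists_isTransferPkg7_of_analytic`) at the bar `θ·transferBarRelIdx L G P r β U 0 j′` from GRID data —
(i) `IsGramBoundedR (Sᵀ·softCovOf K₀ (s_{0,j} − s_{0,j′})·S) κD` (the `D`-line's mass), (ii) the pinned grid kernel norms `N_H` of `e^{Δ_{Sᵀ·softCovOf K₀ s_{0,j′}·S}}·effAction (SᵀC^{K₀}_{>e₀}S)(V_N + 𝒩_{K₀,N})`,
the two a priori rows, and the ONE NUMBER `(4!/(βL²))·(#legs·Σ_{m′>2} C(2m′,4)κD^{2m′−4}N_H(m′)) + 4·mA²·klIdxMass 0 j′ ≤ θ·r·(KlamU)²·klIdxMass 0 j′`. -/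
theorem klmf_baseData_of_gridBinomial {R : RenConsts} {N₀ : ℕ} {G : GeoConsts} (hCF : 0 ≤ G.CF) {P : SplitConsts} (hKl : 0 ≤ P.Klam) {r : ℝ} (hr : 0 ≤ r)
    {β U μ : ℝ} {mA θ : ℝ} (hm : 0 ≤ mA) (hθ0 : 0 ≤ θ)
    (hKf : FrameOK R U N₀ μ (klFlowFrameU L M β U μ 0)) (hβ : klBetaMin ≤ β) (hβL : β ≤ L)
    {j j' : ℕ} (hj : j' ≤ j) (Qm : TorusSite 2 L) {κD : ℝ} (hκD : 0 ≤ κD)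
    (hGB : IsGramBoundedR ((hubbardGridSub L M β (2 * (2 * M))).transpose *
      softCovOf L M β μ (klFlowFrameU L M β U μ 0) ((softSymbolCompl L M β μ (klFlowFrameU L M β U μ 0) 0 j) - (softSymbolCompl L M β μ (klFlowFrameU L M β U μ 0) 0 j')) *
        hubbardGridSub L M β (2 * (2 * M))) κD)
    (NH : ℕ → ℝ) (hNH0 : ∀ m', 0 ≤ NH m')
    (hNH : ∀ m' (i : Fin (2 * m')) (w : GridLeg (GridPoint L (2 * (2 * M)))),
      ∑ Y ∈ univ.filter (fun Y : Fin (2 * m') → GridLeg (GridPoint L (2 * (2 * M))) => Y i = w),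
        ‖kernel ℂ (gaussConv ℂ ((hubbardGridSub L M β (2 * (2 * M))).transpose * softCovOf L M β μ (klFlowFrameU L M β U μ 0) (softSymbolCompl L M β μ (klFlowFrameU L M β U μ 0) 0 j') *
            hubbardGridSub L M β (2 * (2 * M)))
          (effAction ℂ ((hubbardGridSub L M β (2 * (2 * M))).transpose * hubbardCovAboveCT L M β μ 0 (klFlowFrameU L M β U μ 0) klE0 * hubbardGridSub L M β (2 * (2 * M)))
            (hubbardGridInteraction L (2 * (2 * M)) β U + hubbardGridCounterQuadratic L (2 * (2 * M)) β (klFlowFrameU L M β U μ 0)))) (2 * m') Y‖ ≤ NH m')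
    (hA₁ : ∀ x y, ‖klMemberArrayF L M β U μ 0 (softSymbolCompl L M β μ (klFlowFrameU L M β U μ 0) 0 j) Qm x y‖ ≤ mA)
    (hA₂ : ∀ x y, ‖klMemberArrayF L M β U μ 0 (softSymbolCompl L M β μ (klFlowFrameU L M β U μ 0) 0 j') Qm x y‖ ≤ mA)
    (hbud : ((2 * 2).factorial : ℝ) / (β * (L : ℝ) ^ 2) * (Fintype.card (GridLeg (GridPoint L (2 * (2 * M)))) *
          ∑ m' ∈ range (Fintype.card (GridLeg (GridPoint L (2 * (2 * M)))) / 2 + 1), if 2 < m' then ((2 * m').choose (2 * 2) : ℝ) * κD ^ (2 * m' - 2 * 2) * NH m' else 0) +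
        4 * (mA * mA) * klIdxMass 0 j' ≤ θ * (r * ((P.Klam * U) ^ 2 * klIdxMass 0 j'))) :
    ∃ η : TorusSite 2 L → TorusSite 2 L → ℝ,
      (∀ x y, ‖klMemberArrayF L M β U μ 0 (softSymbolCompl L M β μ (klFlowFrameU L M β U μ 0) 0 j) Qm x y‖ ≤ mA) ∧
      (∀ x y, ‖klMemberArrayF L M β U μ 0 (softSymbolCompl L M β μ (klFlowFrameU L M β U μ 0) 0 j') Qm x y‖ ≤ mA) ∧
      (∀ k ∈ klBall L μ 0, ∀ k' ∈ klBall L μ 0,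
        ‖(klMemberArrayF L M β U μ 0 (softSymbolCompl L M β μ (klFlowFrameU L M β U μ 0) 0 j) Qm - klMemberArrayF L M β U μ 0 (softSymbolCompl L M β μ (klFlowFrameU L M β U μ 0) 0 j') Qm) k k'‖ ≤ η k k') ∧
      (∀ k ∈ klBall L μ 0, ∀ k' ∈ klBall L μ 0, η k k' + mA * mA *
        ∑ c, ‖(-(((klTransferWeight L M β μ (klFlowFrameU L M β U μ 0) 0 (softSymbolCompl L M β μ (klFlowFrameU L M β U μ 0) 0 j) Qm c -
          klTransferWeight L M β μ (klFlowFrameU L M β U μ 0) 0 (softSymbolCompl L M β μ (klFlowFrameU L M β U μ 0) 0 j') Qm c : ℝ)) : ℂ))‖ ≤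
        θ * transferBarRelIdx L G P r β U 0 j' Qm k k') := by
  have hβ0 : 0 < β := pos_of_klBetaMin_le hβ
  have hsc : klScale klE0 0 = klE0 := by simp [klScale]
  refine ⟨fun _ _ => ((2 * 2).factorial : ℝ) / (β * (L : ℝ) ^ 2) * (Fintype.card (GridLeg (GridPoint L (2 * (2 * M)))) *
          ∑ m' ∈ range (Fintype.card (GridLeg (GridPoint L (2 * (2 * M)))) / 2 + 1), if 2 < m' then ((2 * m').choose (2 * 2) : ℝ) * κD ^ (2 * m' - 2 * 2) * NH m' else 0),
    hA₁, hA₂, fun k hk k' hk' => ?_, fun k hk k' hk' => ?_⟩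
  · -- the smearing row: the grid binomial–Gram bound at the label tuple of `(k, k′)`
    rw [Matrix.sub_apply, klMemberArrayF_apply_of_mem β U μ 0 _ Qm hk hk', klMemberArrayF_apply_of_mem β U μ 0 _ Qm hk hk']
    have h := klmg_covSmearedPairAmplitude_sub_le_gridBinomial L M hβ0 U μ (klFlowFrameU L M β U μ 0) 0 _ _ hκD hGB NH hNH0 (by rw [hsc]; exact hNH) Qm k k'
    exact h
  · -- the budget row: weight mass `≤ 4·klIdxMass 0 j′` and the bar's floor at `n = 0` (verbatim from row 28)
    have hw : ∑ c, ‖(-(((klTransferWeight L M β μ (klFlowFrameU L M β U μ 0) 0 (softSymbolCompl L M β μ (klFlowFrameU L M β U μ 0) 0 j) Qm c -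
          klTransferWeight L M β μ (klFlowFrameU L M β U μ 0) 0 (softSymbolCompl L M β μ (klFlowFrameU L M β U μ 0) 0 j') Qm c : ℝ)) : ℂ))‖ ≤ 4 * klIdxMass 0 j' := by
      have h := sum_abs_klTransferWeight_compl_sub_le (M := M) β μ (klFlowFrameU L M β U μ 0) hKf hβ hβL (Nat.zero_le j') hj Qm
      refine le_of_eq_of_le ?_ h
      refine Finset.sum_congr rfl fun c _ => ?_
      rw [norm_neg, Complex.norm_real, Real.norm_eq_abs]
    have hfl := transferBarRelIdx_floor_le (L := L) hCF hKl hr β U 0 j' Qm k k'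
    rw [klIdxPrefactor_zero, pow_zero, inv_one, one_mul] at hfl
    have hmm : 0 ≤ mA * mA := mul_nonneg hm hm
    have h1 := mul_le_mul_of_nonneg_left hw hmm
    have h2 := mul_le_mul_of_nonneg_left hfl hθ0
    linarith

end Base

end Summit.HubbardSuperconductivity.HubbardSuperconductivity.Theorems.KLRegimeSplit

end
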